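import Summits.QuantumAdvantage.QuantumAdvantage.Theses.ArithStatLadder
import Literature.NumberTheory.QuadraticFields.ThreeTorsion
import Literature.NumberTheory.QuadraticFields.ScholzHeckeUnitCriterion
import Literature.NumberTheory.QuadraticFields.ScholzHeckeUnitCriterionProofs
import Summits.QuantumAdvantage.QuantumAdvantage.Theorems.AvgFaceBeyondPrior.Negative.AvgFaceBeyondPriorNecessary
import Summits.QuantumAdvantage.QuantumAdvantage.Theorems.AvgFaceBeyondPrior.Negative.AvgFaceBeyondPriorTransfer
import Summits.QuantumAdvantage.QuantumAdvantage.Theorems.ArithStatLadderAvgFaceBeyondPriorMirrorTransport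
import Summits.QuantumAdvantage.QuantumAdvantage.Theorems.ArithStatLadderAvgFaceBeyondPriorMirrorTorsionImpThreeDvd
import Literature.NumberTheory.QuadraticFields.ScholzHeckeUnitCriterionHolds
import Summits.QuantumAdvantage.QuantumAdvantage.Theorems.ArithStatLadderUnitCubeCriterion
import Summits.QuantumAdvantage.QuantumAdvantage.Theorems.ArithStatLadderUnitCubeMemBQP
import Summits.QuantumAdvantage.QuantumAdvantage.Theorems.ArithStatLadderMirrorHeurTransfer
import Summits.QuantumAdvantage.QuantumAdvantage.Theorems.ArithStatLadderMirrorAssembly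
import HarnessLib

/-!
# The mirror line closed modulo its hypothesis: `AvgFaceBeyondPrior ⟺ RealFaceHard`, unconditionally
# (crux stmt-QuantumAdvantage-2427, line `mirror-unit-signature`, skeleton v7 of lead c2)

Topic: route `ArithStatLadder` of `QuantumAdvantage`, crux `AvgFaceBeyondPrior = ((IQ3, U) ∉ Heur_{1/3}BPP)`,
`IQ3 = {bin d : −d fundamental, 3 ∣ h(−d)}` (`Negative.iq3Set`, `Negative.Q`, `Negative.avgFace_iff_Q`).

On 2026-08-16 the two classical stubs of the line landed as tree theorems:
* `Mirror.stub_mirrorTorsionImpThreeDvd` (p105755) — `−d` fundamental, `#Cl₃(D⁺) ≠ 1 ⟹ 3 ∣ h(−d)` (the rank-one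
  shadow of Scholz's `r ≤ s`; cubic class field of `ℚ(√D⁺)` + Scholz's Kummer generator in `ℚ(√−d)`);
* `Mirror.stub_threeDvdImpCube` (p107075) — direction (ii) of the Scholz–Hecke unit criterion, re-homed to Literature as
  `ScholzHecke.three_dvd_imp_cube` with the discharge `ScholzHecke_unitCubeCriterion_holds` (p107486; direction (i) is
  `ScholzHecke.cube_imp_three_dvd`, p92320); hence route item `UnitCubeCriterion` (`UnitCubeCriterion_of_ScholzHecke`).

Consequences recorded here, all UNCONDITIONAL (no named-fact hypothesis left):
* `mem_iq3Set_iff_realFace`, `iq3Set_eq_realFace` — `IQ3 = RealFace := {d : −d fund., d ≠ 3, UnitCubeAtThree d ∨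
  #Cl₃(D⁺) ≠ 1}` as sets;
* `avgFaceBeyondPrior_iff_realFaceHard` — **the crux is LITERALLY the `Heur_{1/3}BPP`-hardness of the real face**
  (the registered hypothesis-type stub `stub_realFaceHard` of the skeleton, verbatim): the line is closed modulo
  exactly this one stub, which is the crux in mirror coordinates (separation-strength: crux ⇒ `IQ3 ∉ BPP`,
  `Negative.avgFace_imp_not_mem_BPP`);
* `quantumAdvantage_of_mirrorRankRare` — **shape M with its class-field-theory debt paid**: `MirrorRankRare →
  AvgFaceBeyondPrior → QuantumAdvantage` (from the landed `MirrorAssembly_proof`, `UnitCubeMemBQP_proof`,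
  `MirrorHeurTransfer_proof` and the two directions of the unit criterion); the only printed-theorem debt left between the crux and the
  summit is `MirrorRankRare` (Davenport–Heilbronn for real fields with a 3-adic condition, Bhargava–Varma Cor. 4);
* `not_avgFace_of_unitCube_approx` — the second refutation surface in APPROXIMATE form: given `MirrorRankRare`, a
  `BPP` statistic agreeing with the mirror unit's cube class off a `(1/6 − η)`-fraction of every late block refutes
  the crux (strengthens `Negative`'s exact-membership version);
* `crux_imp_exists_realFace_level` — the arithmetic necessity in mirror coordinates: the crux forces a level at which
  more than a third of the block lies in the real face (CL value `0.4399`).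

References: A. Scholz, J. reine angew. Math. 166 (1932) 201–203 [Scholz1932]; L. C. Washington, *Introduction to
Cyclotomic Fields*, GTM 83, Thm 10.10 [Washington1997]; A. Bogdanov, L. Trevisan, *Average-case complexity*, §2.3
[BogdanovTrevisan2006]; H. Cohen, H. W. Lenstra, LNM 1068 (1984) §9 (C2) [CohenLenstra1984].
-/

noncomputable section

set_option linter.dupNamespace false -- D-0017: single-problem summit ⇒ `QuantumAdvantage.QuantumAdvantage` by design

open scoped Classical

namespace Summit.QuantumAdvantage.QuantumAdvantage.Theorems.AvgFaceBeyondPrior.Mirror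

open _root_.Computability
open Literature.Computability.Complexity Literature.Computability.MetaComplexity
  Literature.NumberTheory.QuadraticFields
open Summit.QuantumAdvantage.QuantumAdvantage.Theses.ArithStatLadder
open Summit.QuantumAdvantage.QuantumAdvantage.Theorems.AvgFaceBeyondPrior

/-- **`IQ3 = RealFace` pointwise, unconditionally**: for every `d`, `d ∈ IQ3` iff `−d` is fundamental, `d ≠ 3`, and
the mirror unit is a cube at `3` or `#Cl₃(D⁺) ≠ 1` — from the three landed implications
`stub_mirrorTorsionImpThreeDvd`, `ScholzHecke.cube_imp_three_dvd`, `ScholzHecke.three_dvd_imp_cube` (and `h(−3) = 1`).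
[cite: Scholz1932, pp. 201–203] -/
theorem mem_iq3Set_iff_realFace (d : ℕ) :
    d ∈ Negative.iq3Set ↔
      d ∈ {d : ℕ | ((((-(d:ℤ)) % 4 = 1 ∧ Squarefree (-(d:ℤ)) ∧ (-(d:ℤ)) ≠ 1) ∨
        (4 ∣ (-(d:ℤ)) ∧ ((-(d:ℤ)) / 4 % 4 = 2 ∨ (-(d:ℤ)) / 4 % 4 = 3) ∧ Squarefree ((-(d:ℤ)) / 4))) ∧
        d ≠ 3 ∧ (UnitCubeAtThree d ∨
          quadFieldThreeTorsion (if 3 ∣ d then ((d / 3 : ℕ) : ℤ) else 3 * (d : ℤ)) ≠ 1))} := by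
  simp only [Negative.iq3Set, Set.mem_setOf_eq]
  constructor
  · rintro ⟨hf, hdvd⟩
    have hne : d ≠ 3 := by
      rintro rfl
      exact not_three_dvd_classNumber_neg_three hdvd
    refine ⟨hf, hne, ?_⟩
    by_cases ht : quadFieldThreeTorsion (if 3 ∣ d then ((d / 3 : ℕ) : ℤ) else 3 * (d : ℤ)) = 1
    · exact Or.inl (ScholzHecke.three_dvd_imp_cube hf hne ht hdvd)
    · exact Or.inr ht
  · rintro ⟨hf, hne, hc | ht⟩
    · exact ⟨hf, ScholzHecke.cube_imp_three_dvd hf hne hc⟩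
    · exact ⟨hf, stub_mirrorTorsionImpThreeDvd d hf ht⟩

/-- **`IQ3 = RealFace` as sets, unconditionally.** [cite: Scholz1932, pp. 201–203] -/
theorem iq3Set_eq_realFace :
    Negative.iq3Set =
      {d : ℕ | ((((-(d:ℤ)) % 4 = 1 ∧ Squarefree (-(d:ℤ)) ∧ (-(d:ℤ)) ≠ 1) ∨
        (4 ∣ (-(d:ℤ)) ∧ ((-(d:ℤ)) / 4 % 4 = 2 ∨ (-(d:ℤ)) / 4 % 4 = 3) ∧ Squarefree ((-(d:ℤ)) / 4))) ∧
        d ≠ 3 ∧ (UnitCubeAtThree d ∨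
          quadFieldThreeTorsion (if 3 ∣ d then ((d / 3 : ℕ) : ℤ) else 3 * (d : ℤ)) ≠ 1))} :=
  Set.ext mem_iq3Set_iff_realFace

/-- **The crux is literally the hardness of the real face, unconditionally**: `AvgFaceBeyondPrior` holds iff the
real-face problem `(RealFace, U)` is not in `Heur_{1/3}BPP` — the right-hand side is the registered hypothesis-type
stub `stub_realFaceHard` of the line's skeleton, verbatim. So the line `mirror-unit-signature` is closed modulo
exactly that stub, and that stub is the crux itself in mirror coordinates. [cite: BogdanovTrevisan2006, §2.3] -/
theorem avgFaceBeyondPrior_iff_realFaceHard :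
    Summit.QuantumAdvantage.QuantumAdvantage.Theses.ArithStatLadder.AvgFaceBeyondPrior ↔
      (⟨encodingNatBool.toLanguage {d : ℕ | ((((-(d:ℤ)) % 4 = 1 ∧ Squarefree (-(d:ℤ)) ∧ (-(d:ℤ)) ≠ 1) ∨
          (4 ∣ (-(d:ℤ)) ∧ ((-(d:ℤ)) / 4 % 4 = 2 ∨ (-(d:ℤ)) / 4 % 4 = 3) ∧ Squarefree ((-(d:ℤ)) / 4))) ∧
          d ≠ 3 ∧ (UnitCubeAtThree d ∨
            quadFieldThreeTorsion (if 3 ∣ d then ((d / 3 : ℕ) : ℤ) else 3 * (d : ℤ)) ≠ 1))},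
        Negative.ens⟩ : DistProblem) ∉ HeurDeltaBPP (fun _ => (1 : ℝ) / 3) := by
  have hQ : Negative.Q =
      (⟨encodingNatBool.toLanguage {d : ℕ | ((((-(d:ℤ)) % 4 = 1 ∧ Squarefree (-(d:ℤ)) ∧ (-(d:ℤ)) ≠ 1) ∨
          (4 ∣ (-(d:ℤ)) ∧ ((-(d:ℤ)) / 4 % 4 = 2 ∨ (-(d:ℤ)) / 4 % 4 = 3) ∧ Squarefree ((-(d:ℤ)) / 4))) ∧
          d ≠ 3 ∧ (UnitCubeAtThree d ∨
            quadFieldThreeTorsion (if 3 ∣ d then ((d / 3 : ℕ) : ℤ) else 3 * (d : ℤ)) ≠ 1))},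
        Negative.ens⟩ : DistProblem) := by
    show (⟨encodingNatBool.toLanguage Negative.iq3Set, Negative.ens⟩ : DistProblem) = _
    rw [iq3Set_eq_realFace]
  rw [Negative.avgFace_iff_Q, hQ]

/-- **Shape M with its class-field-theory debt paid**: `MirrorRankRare → AvgFaceBeyondPrior → QuantumAdvantage`.
If the summit failed, the GRH-free `BQP` witness `L_ε` (`UnitCubeMemBQP_proof`) would be in `BPP`; by the PROVED unit
criterion (`ScholzHecke_unitCubeCriterion_holds`, route item `UnitCubeCriterion`) its disagreement with `IQ3` sits inside `{#Cl₃(ℚ(√3d)) ≠ 1}`, of density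
`≤ 1/6 + ε` by `MirrorRankRare`, and the transfer (`MirrorHeurTransfer_proof`) refutes the crux. So between the crux
and the summit the only remaining debt is the printed theorem `MirrorRankRare` (Bhargava–Varma 2016, Cor. 4).
[cite: Washington1997, Thm 10.10] -/
theorem quantumAdvantage_of_mirrorRankRare
    (hR : Summit.QuantumAdvantage.QuantumAdvantage.Theses.ArithStatLadder.MirrorRankRare)
    (hc : Summit.QuantumAdvantage.QuantumAdvantage.Theses.ArithStatLadder.AvgFaceBeyondPrior) :
    _root_.QuantumAdvantage :=
  Summit.QuantumAdvantage.QuantumAdvantage.Theorems.ArithStatLadder.MirrorAssembly_proof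
    (Summit.QuantumAdvantage.QuantumAdvantage.Theorems.ArithStatLadder.UnitCubeCriterion_of_ScholzHecke
      ScholzHecke_unitCubeCriterion_holds)
    hR Summit.QuantumAdvantage.QuantumAdvantage.Theorems.ArithStatLadder.UnitCubeMemBQP_proof
    Summit.QuantumAdvantage.QuantumAdvantage.Theorems.ArithStatLadder.MirrorHeurTransfer_proof hc

/-- **The arithmetic necessity of the crux in mirror coordinates, unconditionally**: `AvgFaceBeyondPrior` forces a
level `n` (with a nonempty block) at which `#𝒟ₙ < 3·#{d ∈ 𝒟ₙ : −d fund., d ≠ 3, UnitCubeAtThree d ∨ #Cl₃(D⁺) ≠ 1}`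
— the landed `Negative.avgFace_imp_exists_level` rewritten along `IQ3 = RealFace` (its `∀ N ∃ n ≥ N` sharpening
`Negative.avgFace_imp_exists_level_ge`, Negative/AvgFaceBeyondPriorOften.lean, transports the same way). Cohen–Lenstra
value of the limiting proportion `1 − ∏(1 − 3^{−i}) = 0.4399`, numerically `0.40` at `n = 19`; beyond small `n` not a
theorem in print. [cite: CohenLenstra1984, §9 (C2)] -/
theorem crux_imp_exists_realFace_level
    (hc : Summit.QuantumAdvantage.QuantumAdvantage.Theses.ArithStatLadder.AvgFaceBeyondPrior) :
    ∃ n, (Negative.fundBlock n).Nonempty ∧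
      ((Negative.fundBlock n).card : ℝ) <
        3 * ((Negative.fundBlock n).filter fun d : ℕ =>
          d ∈ {d : ℕ | ((((-(d:ℤ)) % 4 = 1 ∧ Squarefree (-(d:ℤ)) ∧ (-(d:ℤ)) ≠ 1) ∨
            (4 ∣ (-(d:ℤ)) ∧ ((-(d:ℤ)) / 4 % 4 = 2 ∨ (-(d:ℤ)) / 4 % 4 = 3) ∧ Squarefree ((-(d:ℤ)) / 4))) ∧
            d ≠ 3 ∧ (UnitCubeAtThree d ∨
              quadFieldThreeTorsion (if 3 ∣ d then ((d / 3 : ℕ) : ℤ) else 3 * (d : ℤ)) ≠ 1))}).card := by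
  obtain ⟨n, hne, hlt⟩ := Negative.avgFace_imp_exists_level hc
  refine ⟨n, hne, ?_⟩
  have hfilter : ((Negative.fundBlock n).filter fun d : ℕ => 3 ∣ BinaryQuadraticForm.classNumber (-(d:ℤ))) =
      (Negative.fundBlock n).filter fun d : ℕ =>
        d ∈ {d : ℕ | ((((-(d:ℤ)) % 4 = 1 ∧ Squarefree (-(d:ℤ)) ∧ (-(d:ℤ)) ≠ 1) ∨
          (4 ∣ (-(d:ℤ)) ∧ ((-(d:ℤ)) / 4 % 4 = 2 ∨ (-(d:ℤ)) / 4 % 4 = 3) ∧ Squarefree ((-(d:ℤ)) / 4))) ∧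
          d ≠ 3 ∧ (UnitCubeAtThree d ∨
            quadFieldThreeTorsion (if 3 ∣ d then ((d / 3 : ℕ) : ℤ) else 3 * (d : ℤ)) ≠ 1))} := by
    refine Finset.filter_congr fun d hd => ?_
    have hf := (Finset.mem_filter.1 hd).2
    rw [← mem_iq3Set_iff_realFace d]
    exact ⟨fun hdvd => ⟨hf, hdvd⟩, fun h => h.2⟩
  rw [← hfilter]
  exact hlt


/-- **Second refutation surface, approximate form** (strengthens the landed `not_avgFace_of_unitCubeLang_mem_BPP`,
which needs the unit language to be EXACTLY in `BPP`): given `MirrorRankRare`, any `BPP` statistic `K` of `d` that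
agrees with the cube class of the mirror unit `UnitCubeAtThree d` off a `(1/6 − η)`-fraction of every late block,
for some `η > 0`, refutes the crux. Indeed on a block with `n ≥ 3` (so `d ≠ 3`) a disagreement of `K` with
`3 ∣ h(−d)` is either a disagreement of `K` with `UnitCubeAtThree d`, or a point with `3 ∣ h(−d)`, no cube, hence
`#Cl₃(D⁺) ≠ 1` by direction (ii) (`ScholzHecke.three_dvd_imp_cube`; the case "cube but `3 ∤ h`" is excluded by direction
(i), `ScholzHecke.cube_imp_three_dvd`); so the disagreement density is `≤ (1/6 − η) + (1/6 + η) = 1/3`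
eventually, and `Negative.not_avgFace_of_eventually_agree` applies. This is the exact target for the disprover's
unit-residue statistics: a classical predictor of `ε_{ℚ(√3d)} mod 9` right on `> 5/6` of every late block kills
the crux. [cite: BogdanovTrevisan2006, §2.3] -/
theorem not_avgFace_of_unitCube_approx
    (hR : Summit.QuantumAdvantage.QuantumAdvantage.Theses.ArithStatLadder.MirrorRankRare)
    {K : Set ℕ} (hK : encodingNatBool.toLanguage K ∈ BPP) {η : ℝ} (hη : 0 < η)
    (hagree : ∀ᶠ n : ℕ in Filter.atTop,
      ((((Negative.fundBlock n).filter fun d : ℕ => ¬ (UnitCubeAtThree d ↔ d ∈ K)).card : ℝ))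
        ≤ (1 / 6 - η) * ((Negative.fundBlock n).card : ℝ)) :
    ¬ Summit.QuantumAdvantage.QuantumAdvantage.Theses.ArithStatLadder.AvgFaceBeyondPrior := by
  refine Negative.not_avgFace_of_eventually_agree hK (inst := inferInstance) ?_
  have hRR := hR η hη
  filter_upwards [hagree, hRR, Filter.eventually_ge_atTop 3] with n hn hRn hn3
  -- pointwise: a disagreement with `3 ∣ h(−d)` is a unit disagreement or a mirror-torsion point
  have hsub : ((Negative.fundBlock n).filter fun d : ℕ =>
        ¬ (3 ∣ BinaryQuadraticForm.classNumber (-(d:ℤ)) ↔ d ∈ K)) ⊆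
      ((Negative.fundBlock n).filter fun d : ℕ => ¬ (UnitCubeAtThree d ↔ d ∈ K)) ∪
        ((Negative.fundBlock n).filter fun d : ℕ =>
          quadFieldThreeTorsion (if 3 ∣ d then ((d / 3 : ℕ) : ℤ) else 3 * (d : ℤ)) ≠ 1) := by
    intro d hd
    rw [Finset.mem_filter] at hd
    obtain ⟨hdB, hdis⟩ := hd
    have hdB' := (@Finset.mem_filter _ _ (_) _ _).1 hdB
    have hf := hdB'.2
    have hIco := Finset.mem_Ico.1 hdB'.1
    have hd3 : d ≠ 3 := by
      rintro rfl
      have h4 : 2 ^ 2 ≤ 2 ^ (n - 1) := Nat.pow_le_pow_right (by norm_num) (by omega)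
      omega
    rw [Finset.mem_union, Finset.mem_filter, Finset.mem_filter]
    by_cases ht : quadFieldThreeTorsion (if 3 ∣ d then ((d / 3 : ℕ) : ℤ) else 3 * (d : ℤ)) = 1
    · left
      refine ⟨hdB, fun hiff => hdis ?_⟩
      constructor
      · intro hdvd
        exact hiff.1 (ScholzHecke.three_dvd_imp_cube hf hd3 ht hdvd)
      · intro hK'
        exact ScholzHecke.cube_imp_three_dvd hf hd3 (hiff.2 hK')
    · right
      exact ⟨hdB, ht⟩
  have hcard := Finset.card_le_card hsub
  have hunion := Finset.card_union_le
    ((Negative.fundBlock n).filter fun d : ℕ => ¬ (UnitCubeAtThree d ↔ d ∈ K))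
    ((Negative.fundBlock n).filter fun d : ℕ =>
      quadFieldThreeTorsion (if 3 ∣ d then ((d / 3 : ℕ) : ℤ) else 3 * (d : ℤ)) ≠ 1)
  have h1 : ((((Negative.fundBlock n).filter fun d : ℕ =>
        ¬ (3 ∣ BinaryQuadraticForm.classNumber (-(d:ℤ)) ↔ d ∈ K)).card : ℕ) : ℝ)
      ≤ (((Negative.fundBlock n).filter fun d : ℕ => ¬ (UnitCubeAtThree d ↔ d ∈ K)).card : ℝ) +
        (((Negative.fundBlock n).filter fun d : ℕ =>
          quadFieldThreeTorsion (if 3 ∣ d then ((d / 3 : ℕ) : ℤ) else 3 * (d : ℤ)) ≠ 1).card : ℝ) := by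
    exact_mod_cast hcard.trans hunion
  have hRn' : ((((Negative.fundBlock n).filter fun d : ℕ =>
      quadFieldThreeTorsion (if 3 ∣ d then ((d / 3 : ℕ) : ℤ) else 3 * (d : ℤ)) ≠ 1).card : ℕ) : ℝ)
      ≤ (1 / 6 + η) * ((Negative.fundBlock n).card : ℝ) := hRn
  have h3 : (3:ℝ) * (((Negative.fundBlock n).filter fun d : ℕ =>
        ¬ (3 ∣ BinaryQuadraticForm.classNumber (-(d:ℤ)) ↔ d ∈ K)).card : ℝ)
      ≤ ((Negative.fundBlock n).card : ℝ) := by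
    nlinarith [hn, hRn', h1]
  exact_mod_cast h3

end Summit.QuantumAdvantage.QuantumAdvantage.Theorems.AvgFaceBeyondPrior.Mirror

end
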